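import Literature.AlgebraicGeometry.Hu2025.Statements.S01S09Interface.R110cUniversalityInterface
import Mathlib.Tactic.IntervalCases
import HarnessLib

/-!
# §9 bookkeeping discharges for row 110 file c: the lattice points of `Δ^{d,n}` (`C72L52_holds`) and
# «`x_u ∈ Δ^{d,n}_d` ↔ `VertexMem d u`» (`vertexOf_mem_matroidPolytope_iff`) — res-type-024 gen 11.
Kernel support on OUR typed carriers (`hypersimplex`, `vertexOf`, `matroidPolytope`, `VertexMem`, `C72L52`); nothing of
[Hu25]/[La03] asserted. AI proving is weaker than expert review.
-/

namespace Literature.AlgebraicGeometry.Hu2025.Statements.S01S09Interface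

open Finset

/-- `Σ_{α ∈ I} (x_u)_α = |u ∩ I|` (as a real number).
[cite: Hu2025, §9 (9.1) chunk p0072 l.42–60 (unrefereed preprint arXiv:2507.21400v1 under adjudication, D-0012/D-0089 —
kernel support on OUR typed carriers of row 110; nothing of the source asserted)] -/
theorem sum_vertexOf_eq_card_inter {n : ℕ} (u I : Finset (Fin n)) :
    ∑ α ∈ I, vertexOf u α = ((u ∩ I).card : ℝ) := by
  simp only [vertexOf, Finset.sum_boole, Finset.filter_mem_eq_inter, Finset.inter_comm I u]

/-- `Σ_α (x_u)_α = |u|`.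
[cite: Hu2025, §9 (9.1) chunk p0072 l.42–53 (unrefereed preprint under adjudication — kernel support on OUR typed carriers;
nothing of the source asserted)] -/
theorem sum_vertexOf_eq_card {n : ℕ} (u : Finset (Fin n)) : ∑ α, vertexOf u α = (u.card : ℝ) := by
  rw [sum_vertexOf_eq_card_inter, Finset.inter_univ]

/-- `x_u ∈ Δ^{d,n}` iff `|u| = d`.
[cite: Hu2025, §9 chunk p0072 l.37–53 (unrefereed preprint under adjudication — kernel support on OUR typed carriers;
nothing of the source asserted)] -/
theorem vertexOf_mem_hypersimplex_iff {n d : ℕ} (u : Finset (Fin n)) :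
    vertexOf u ∈ hypersimplex n d ↔ u.card = d := by
  simp only [hypersimplex, Set.mem_setOf_eq, sum_vertexOf_eq_card, Nat.cast_inj]
  constructor
  · exact fun h => h.2
  · intro h
    refine ⟨fun α => ?_, h⟩
    unfold vertexOf
    split_ifs <;> norm_num

/-- **The bookkeeping fact left unproved in file c's `VertexMem` docstring**: `x_u ∈ Δ^{d,n}_d` (membership of the
vertex (9.1) in the real matroid subpolytope) iff `VertexMem d u` (`|u| = d ∧ ∀ I, d_I ≤ |u ∩ I|`).
[cite: Hu2025, §9 chunk p0072 l.55–60 with (9.1) (unrefereed preprint arXiv:2507.21400v1 under adjudication, D-0012/D-0089 —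
kernel support on OUR typed carriers of row 110; nothing of the source asserted)] -/
theorem vertexOf_mem_matroidPolytope_iff {n d : ℕ} (M : HuMatroid n d) (u : Finset (Fin n)) :
    vertexOf u ∈ matroidPolytope M ↔ VertexMem M u := by
  simp only [matroidPolytope, Set.mem_setOf_eq, vertexOf_mem_hypersimplex_iff, sum_vertexOf_eq_card_inter, Nat.cast_le]
  rfl

/-- **`C72L52` HOLDS as typed** («`Δ^{d,n} ∩ ℕ^n = {x_i ∣ i ∈ 𝕀_{d,n}}`»: the points of `Δ^{d,n}` with natural-number
coordinates are exactly the `x_u`, `|u| = d`): a coordinate in `[0,1] ∩ ℕ` is `0` or `1`.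
[cite: Hu2025, §9 chunk p0072 l.52–53 (unrefereed preprint arXiv:2507.21400v1 under adjudication, D-0012/D-0089 — kernel
proof of OUR typed reading `C72L52`; nothing of the source asserted; the «vertices» clause is not typed)] -/
theorem C72L52_holds (n d : ℕ) : C72L52 n d := by
  intro x
  constructor
  · rintro ⟨⟨hx01, hsum⟩, hint⟩
    -- every coordinate is 0 or 1
    have h01 : ∀ α, x α = 0 ∨ x α = 1 := by
      intro α
      obtain ⟨m, hm⟩ := hint α
      obtain ⟨h0, h1⟩ := hx01 α
      rw [hm] at h0 h1 ⊢
      have : m ≤ 1 := by exact_mod_cast h1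
      interval_cases m <;> simp
    classical
    refine ⟨Finset.univ.filter fun α => x α = 1, ?_, ?_⟩
    · have hx : x = vertexOf (Finset.univ.filter fun α => x α = 1) := by
        funext α
        unfold vertexOf
        rcases h01 α with h | h <;> simp [h]
      have := sum_vertexOf_eq_card (Finset.univ.filter fun α => x α = 1)
      rw [← hx, hsum, Nat.cast_inj] at this
      exact this.symm
    · funext α
      unfold vertexOf
      rcases h01 α with h | h <;> simp [h]
  · rintro ⟨u, hu, rfl⟩
    refine ⟨(vertexOf_mem_hypersimplex_iff u).2 hu, fun α => ?_⟩
    unfold vertexOf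
    split_ifs
    · exact ⟨1, by norm_num⟩
    · exact ⟨0, by norm_num⟩

end Literature.AlgebraicGeometry.Hu2025.Statements.S01S09Interface
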